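import Mathlib
import HarnessLib
import Literature.AlgebraicGeometry.Ramification.InertiaNormalSylow
import Literature.AlgebraicGeometry.Resolution.Blowups
import Summits.ResolutionOfSingularities.ResolutionOfSingularities.Theorems.WildQuotientsWildQuotientResolutionStubInertiaLe
import Summits.ResolutionOfSingularities.ResolutionOfSingularities.Theorems.WildQuotientsWildQuotientResolutionPointMoveNpcClosedPoints

/-!
# The round invariant of the threefold Phase 0: «every non-p-closed point is closed» survives a point move (crux `WildQuotients.WildQuotientResolution`)

Crux stmt-ResolutionOfSingularities-15640 (`WildQuotientResolution`), registered stub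
`stub_phaseZeroHighDim`, move-game track (`…PointMove` p810587). The invariant of the rounds of
the terminating design (memo `PHASE0-DIM3-TERMINATION.md` §3, addendum v2 (R8)): after the NPC
curves of round 0 have been blown up, **the non-p-closed locus consists of closed points, and this
persists under point moves.** Indeed, for the equivariant blow-up `π : X♯ → X′` of a finite stable
set `Z` of closed points (regular threefold near `Z`, residue characteristics `p`) and a
non-p-closed point `x ∈ X♯`: if `π x ∈ Z`, `x` is closed by
✓`isClosed_and_surjective_of_not_hasNormalSylow_inertia`; if `π x ∉ Z`, then `π x` is non-p-closed
(`I_x ≤ I_{π x}`, ✓`InertiaLe.stub_inertia_le`) hence closed by the invariant downstairs, and a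
specialisation `x ⤳ x′` maps to `π x ⤳ π x′`, so `π x′ = π x ∉ Z` and `x′ = x` because `π` is an
isomorphism — in particular injective — off `Z` (`IsBlowup.isIso_compl`).

* `isClosed_singleton_of_not_hasNormalSylow_inertia_of_pointMove` — the invariant step.

[OURS · crux stmt-ResolutionOfSingularities-15640 · helper toward `stub_phaseZeroHighDim`
(threefold Phase 0, round invariant); folklore, counted 0; AI-level work, weaker than expert
review.]
-/

-- single-problem summit: the doubled namespace component `ResolutionOfSingularities` is forced
set_option linter.dupNamespace false

namespace Summit.ResolutionOfSingularities.ResolutionOfSingularities.Theorems.WildQuotientResolution.PointMoveNoNpcCurves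

open CategoryTheory AlgebraicGeometry TopologicalSpace IsLocalRing
open Literature.AlgebraicGeometry.Resolution Literature.AlgebraicGeometry.Ramification

set_option maxHeartbeats 400000 in
/-- **«NPC ⊆ closed points» persists under point moves (regular threefold).** Setting of
✓`isClosed_and_surjective_of_not_hasNormalSylow_inertia`, with the threefold/characteristic
hypotheses at the points of `Z` given pointwise; assume every non-p-closed point of `X′` is closed.
Then every non-p-closed point of `X♯` is closed. [folklore] -/
theorem isClosed_singleton_of_not_hasNormalSylow_inertia_of_pointMove (p : ℕ) [Fact p.Prime]
    {X' X₁ : Scheme.{0}} (q : X' ⟶ X₁) [IsAffineHom q]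
    {G : Type} [Group G] [Finite G] (ρ : G →* Aut X') (hfaith : Function.Injective ρ)
    (hρ : ∀ g : G, (ρ g).hom ≫ q = q) [IsIntegral X'] [IsLocallyNoetherian X']
    [JacobsonSpace X']
    {Z : Set X'} (hZc : IsClosed Z) (hZf : Z.Finite) (hZpt : ∀ z ∈ Z, IsClosed ({z} : Set X'))
    {Xs : Scheme.{0}} {π : Xs ⟶ X'}
    (hπ : IsBlowup π (Scheme.IdealSheafData.vanishingIdeal ⟨Z, hZc⟩)) [IsIntegral Xs]
    [JacobsonSpace Xs]
    (ρs : G →* Aut Xs) (hequiv : ∀ g : G, (ρs g).hom ≫ π = π ≫ (ρ g).hom)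
    (hcharZ : ∀ x : Xs, π.base x ∈ Z → CharP (ResidueField (X'.presheaf.stalk (π.base x))) p)
    (hcharX : ∀ x : Xs, π.base x ∈ Z → CharP (ResidueField (Xs.presheaf.stalk x)) p)
    (hregZ : ∀ x : Xs, π.base x ∈ Z → IsRegularLocalRing (X'.presheaf.stalk (π.base x)))
    (hdimZ : ∀ x : Xs, π.base x ∈ Z → ringKrullDim (X'.presheaf.stalk (π.base x)) = (3 : ℕ))
    (hbase : ∀ y : X', ¬ HasNormalSylow p (inertiaSubgroup ρ y) → IsClosed ({y} : Set X'))
    (x : Xs) (hnpc : ¬ HasNormalSylow p (inertiaSubgroup ρs x)) :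
    IsClosed ({x} : Set Xs) := by
  by_cases hxZ : π.base x ∈ Z
  · haveI := hcharZ x hxZ
    haveI := hcharX x hxZ
    haveI := hregZ x hxZ
    exact (isClosed_and_surjective_of_not_hasNormalSylow_inertia p q ρ hfaith hρ hZc hZf hZpt hπ
      ρs hequiv x hxZ (hdimZ x hxZ) hnpc).1
  · -- `π x ∉ Z` is non-p-closed (`I_x ≤ I_{π x}`), hence closed
    have hy : ¬ HasNormalSylow p (inertiaSubgroup ρ (π.base x)) := fun h =>
      hnpc ((h.subgroup ((inertiaSubgroup ρs x).subgroupOf (inertiaSubgroup ρ (π.base x)))).of_mulEquiv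
        (Subgroup.subgroupOfEquivOfLe (InertiaLe.stub_inertia_le ρs ρ π hequiv x)))
    have hycl : IsClosed ({π.base x} : Set X') := hbase _ hy
    -- `π` is an isomorphism (in particular injective) off `Z`
    set W₀ : X'.Opens := ⟨((Scheme.IdealSheafData.vanishingIdeal (⟨Z, hZc⟩ : Closeds X')).support :
        Set X')ᶜ, (Scheme.IdealSheafData.vanishingIdeal (⟨Z, hZc⟩ : Closeds X')).support.isClosed.isOpen_compl⟩
      with hW₀
    haveI : IsIso (π ∣_ W₀) := hπ.isIso_compl
    have hmemW : ∀ y : Xs, y ∈ π ⁻¹ᵁ W₀ ↔ π.base y ∉ Z := fun y => by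
      change π.base y ∈ ((Scheme.IdealSheafData.vanishingIdeal (⟨Z, hZc⟩ : Closeds X')).support :
        Set X')ᶜ ↔ _
      rw [Scheme.IdealSheafData.coe_support_vanishingIdeal]
      rfl
    have hinj : Function.Injective (π ∣_ W₀).base :=
      (TopCat.homeoOfIso (asIso (π ∣_ W₀).base)).injective
    -- a specialisation of `x` stays over `π x`, hence equals `x`
    rw [← closure_subset_iff_isClosed]
    intro x' hx'
    have hspec : x ⤳ x' := specializes_iff_mem_closure.mpr hx'
    have hπspec : π.base x ⤳ π.base x' := hspec.map π.continuous
    have hπeq : π.base x' = π.base x := by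
      have : π.base x' ∈ closure ({π.base x} : Set X') := specializes_iff_mem_closure.mp hπspec
      rw [hycl.closure_eq] at this
      exact this
    have hx'W : x' ∈ π ⁻¹ᵁ W₀ := (hmemW x').mpr (by rw [hπeq]; exact hxZ)
    have hxW : x ∈ π ⁻¹ᵁ W₀ := (hmemW x).mpr hxZ
    have heq : (⟨x', hx'W⟩ : π ⁻¹ᵁ W₀) = ⟨x, hxW⟩ := by
      apply hinj
      apply Subtype.ext
      rw [morphismRestrict_base_coe, morphismRestrict_base_coe]
      exact hπeq
    exact congrArg Subtype.val heq

end Summit.ResolutionOfSingularities.ResolutionOfSingularities.Theorems.WildQuotientResolution.PointMoveNoNpcCurves
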